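import Literature.Analysis.FluidPDE.ForwardDSSLocalLeray
import Literature.Analysis.FluidPDE.CaloricLocalLeray
import HarnessLib

/-!
# [BT1] §4: the energy-type local Leray clauses of an ansatz pair

Analysis/FluidPDE proof file (theorems only) in the decomposition of
`Literature.Analysis.FluidPDE.bradshawTsai2017_dss_localLeray_existence` (Bradshaw–Tsai, Ann.
Henri Poincaré 18 (2017) [BT1], Thm 1.2): it derives four of the seven clauses of
`IsLocalLeraySolution 1 v₀ v π` for an ansatz pair `BradshawTsai2017.IsAnsatzSolution λ v₀ v π`
(`ForwardDSSLocalLeray`) from the linear local Leray bounds of the caloric extension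
`IsCaloricLocalLerayField v₀ (e^{·Δ}v₀)` (`CaloricLocalLeray`), following [BT1] §4 literally:
every clause is the pointwise splitting `|v|² ≤ 2|v − e^{tΔ}v₀|² + 2|e^{tΔ}v₀|²` against the
`t^{1/4}`-law `‖v(t) − e^{tΔ}v₀‖²_{L²(ℝ³)} ≤ C√t` (proved in `ForwardDSSLocalLeray`) and the
corresponding heat-flow bound.

* `IsAnsatzSolution.setLIntegral_sub_heat_sq_lt_top`: `v − e^{tΔ}v₀ ∈ L²((0,T) × ℝ³)` ((4.1)).
* `IsAnsatzSolution.sqIntegrable`: `v ∈ L²((0,T) × K)` ("Locally finite energy").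
* `IsAnsatzSolution.uniformLocalEnergy`: `sup_{0<t<R²} sup_{x₀} ∫_{B_R(x₀)} |v(t)|² < ∞`.
* `IsAnsatzSolution.initial`: `∫_K |v(t) − v₀|² → 0` ("Convergence to initial data").
* `IsAnsatzSolution.tendsto_tail_sub_heat`, `.tendsto_cocompact_sub_heat`, `.decay`:
  `∫₀^{R²}∫_{B_R(x₀)} |v|² → 0` as `|x₀| → ∞` ("Decay at spatial infinity": the finite space–time
  energy of `v − e^{tΔ}v₀` is exhausted by cylinders, plus the decay of the heat flow).

Measurability bookkeeping: the splitting `∫(f+g) = ∫f + ∫g` in `ℝ≥0∞` needs one a.e.-measurable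
summand, always taken to be the caloric one (continuous on the open slab).

## References

* Z. Bradshaw, T.-P. Tsai, Ann. Henri Poincaré 18 (2017) = arXiv:1510.07504, §4 (proof of
  Thm 1.2) [BradshawTsai2017AHP].
-/

noncomputable section

open MeasureTheory Set Function Filter Topology TopologicalSpace Metric Module
open scoped NNReal ENNReal InnerProductSpace RealInnerProductSpace

namespace Literature.Analysis.FluidPDE

namespace BradshawTsai2017

/-- Local notation for physical space `ℝ³ = EuclideanSpace ℝ (Fin 3)`. -/
local notation "ℝ³" => EuclideanSpace ℝ (Fin 3)

variable {c : ℝ} {v₀ : ℝ³ → ℝ³} {v : ℝ → ℝ³ → ℝ³} {π : ℝ → ℝ³ → ℝ}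

/-- The restriction of Lebesgue measure on `ℝ × ℝ³` to a product set is the product of the
restrictions. [folklore] -/
theorem volume_restrict_prod (I : Set ℝ) (S : Set ℝ³) :
    (volume : Measure (ℝ × ℝ³)).restrict (I ×ˢ S) =
      ((volume : Measure ℝ).restrict I).prod ((volume : Measure ℝ³).restrict S) := by
  rw [Measure.volume_eq_prod, Measure.prod_restrict]

/-- **`v − e^{tΔ}v₀ ∈ L²((0,T) × ℝ³)`** for an ansatz pair ([BT1] §4, (4.1):
"`v − e^{tΔ}v₀ ∈ L^∞(0,λ²;L²(ℝ³))`", here from the `t^{1/4}`-law integrated in time: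
`∫₀ᵀ∫ |v − e^{tΔ}v₀|² ≤ T · C √T`). [cite: BradshawTsai2017AHP, §4 (proof of Thm 1.2)] -/
theorem IsAnsatzSolution.setLIntegral_sub_heat_sq_lt_top (h : IsAnsatzSolution c v₀ v π)
    (hc : 1 < c) (hv₀ : FluidPDE.nsRescaleData c v₀ = v₀) (T : ℝ) :
    ∫⁻ z in Ioo 0 T ×ˢ (univ : Set ℝ³),
      ‖v z.1 z.2 - UnboundedOperators.heatExtension v₀ z.1 z.2‖ₑ ^ 2 < ⊤ := by
  obtain ⟨C, hC⟩ := h.lintegral_enorm_sub_heat_sq_le hc hv₀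
  rw [volume_restrict_prod, Measure.restrict_univ]
  refine (lintegral_prod_le _).trans_lt ?_
  have hb : ∀ t ∈ Ioo 0 T, ∫⁻ x, ‖v t x - UnboundedOperators.heatExtension v₀ t x‖ₑ ^ 2 ≤
      C * ENNReal.ofReal (Real.sqrt T) := fun t ht =>
    (hC t ht.1).trans (mul_le_mul_right (ENNReal.ofReal_le_ofReal
      (Real.sqrt_le_sqrt ht.2.le)) _)
  calc ∫⁻ t in Ioo 0 T, ∫⁻ x, ‖v (t, x).1 (t, x).2 -
          UnboundedOperators.heatExtension v₀ (t, x).1 (t, x).2‖ₑ ^ 2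
      ≤ ∫⁻ _ in Ioo 0 T, C * ENNReal.ofReal (Real.sqrt T) := setLIntegral_mono' measurableSet_Ioo hb
    _ < ⊤ := by
        rw [setLIntegral_const]
        exact ENNReal.mul_lt_top (ENNReal.mul_lt_top ENNReal.coe_lt_top ENNReal.ofReal_lt_top)
          (by simp [Real.volume_Ioo])

/-- `‖a + b‖ₑ² ≤ 2‖a‖ₑ² + 2‖b‖ₑ²` in `ℝ≥0∞`. [folklore] -/
theorem enorm_add_sq_le (a b : ℝ³) : ‖a + b‖ₑ ^ 2 ≤ 2 * ‖a‖ₑ ^ 2 + 2 * ‖b‖ₑ ^ 2 := by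
  have := BradshawTsai2019.enorm_sq_le_two_mul_sub_sq_add (a + b) b
  rwa [add_sub_cancel_right] at this

/-- Pointwise splitting `v = (v − e^{tΔ}v₀) + e^{tΔ}v₀` at the level of `‖·‖ₑ²`. [folklore] -/
theorem enorm_sq_le_sub_heat_add (t : ℝ) (x : ℝ³) :
    ‖v t x‖ₑ ^ 2 ≤ 2 * ‖v t x - UnboundedOperators.heatExtension v₀ t x‖ₑ ^ 2 +
      2 * ‖UnboundedOperators.heatExtension v₀ t x‖ₑ ^ 2 := by
  have := enorm_add_sq_le (v t x - UnboundedOperators.heatExtension v₀ t x)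
    (UnboundedOperators.heatExtension v₀ t x)
  rwa [sub_add_cancel] at this

/-- The caloric field is a.e.-measurable (indeed continuous) on every `(0,T) × S`. [folklore] -/
theorem _root_.Literature.Analysis.FluidPDE.IsCaloricLocalLerayField.aemeasurable_enorm_sq
    {V : ℝ → ℝ³ → ℝ³}
    (hV : IsCaloricLocalLerayField v₀ V) (T : ℝ) (S : Set ℝ³) (hS : MeasurableSet S) :
    AEMeasurable (fun z : ℝ × ℝ³ => ‖V z.1 z.2‖ₑ ^ 2) (volume.restrict (Ioo 0 T ×ˢ S)) := by
  have h1 : AEStronglyMeasurable (uncurry V) (volume.restrict (Ioo 0 T ×ˢ S)) :=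
    (hV.continuousOn.mono (prod_mono Ioo_subset_Ioi_self (subset_univ S))).aestronglyMeasurable
      (measurableSet_Ioo.prod hS)
  exact h1.aemeasurable.enorm.pow_const 2

/-- The caloric field is square integrable on `(0,T) × K`, `K` compact (from the uniformly local
energy bound at a radius `R` with `K ⊆ B_R(0)`, `T ≤ R²`). [folklore] -/
theorem _root_.Literature.Analysis.FluidPDE.IsCaloricLocalLerayField.setLIntegral_sq_lt_top
    {V : ℝ → ℝ³ → ℝ³}
    (hV : IsCaloricLocalLerayField v₀ V) (T : ℝ) {K : Set ℝ³} (hK : IsCompact K) :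
    ∫⁻ z in Ioo 0 T ×ˢ K, ‖V z.1 z.2‖ₑ ^ 2 < ⊤ := by
  obtain ⟨R₀, -, hR₀⟩ := hK.isBounded.subset_ball_lt 0 (0 : ℝ³)
  set R : ℝ := max (max R₀ (Real.sqrt T)) 1 with hR
  have hRpos : 0 < R := lt_of_lt_of_le zero_lt_one (le_max_right _ _)
  have hKR : K ⊆ ball (0 : ℝ³) R := hR₀.trans (ball_subset_ball ((le_max_left _ _).trans (le_max_left _ _)))
  have hTR : T ≤ R ^ 2 := by
    rcases le_or_gt T 0 with hT | hT
    · exact hT.trans (sq_nonneg R)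
    · calc T = Real.sqrt T ^ 2 := (Real.sq_sqrt hT.le).symm
        _ ≤ R ^ 2 := pow_le_pow_left₀ (Real.sqrt_nonneg T)
            ((le_max_right _ _).trans (le_max_left _ _)) 2
  obtain ⟨C, hC⟩ := hV.uniformLocalEnergy R hRpos
  calc ∫⁻ z in Ioo 0 T ×ˢ K, ‖V z.1 z.2‖ₑ ^ 2
      ≤ ∫⁻ z in Ioo 0 T ×ˢ ball (0 : ℝ³) R, ‖V z.1 z.2‖ₑ ^ 2 :=
        lintegral_mono_set (prod_mono Subset.rfl hKR)
    _ ≤ ∫⁻ t in Ioo 0 T, ∫⁻ x in ball (0 : ℝ³) R, ‖V (t, x).1 (t, x).2‖ₑ ^ 2 := by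
        rw [volume_restrict_prod]; exact lintegral_prod_le _
    _ ≤ ∫⁻ _ in Ioo 0 T, (C : ℝ≥0∞) :=
        setLIntegral_mono' measurableSet_Ioo fun t ht => hC t ⟨ht.1, ht.2.trans_le hTR⟩ 0
    _ < ⊤ := by
        rw [setLIntegral_const]
        exact ENNReal.mul_lt_top ENNReal.coe_lt_top (by simp [Real.volume_Ioo])

/-- **`v ∈ L²_loc(ℝ³ × [0,∞))`** for an ansatz pair whose caloric part obeys the linear local
Leray bounds: `∫∫_{(0,T)×K} |v|² ≤ 2∫∫ |v − e^{tΔ}v₀|² + 2∫∫_{(0,T)×K} |e^{tΔ}v₀|² < ∞`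
([BT1] §4: "Locally finite energy … follows from inequality (4.1) noting that … `e^{tΔ}v₀` has
uniformly locally finite energy"). [cite: BradshawTsai2017AHP, §4 (proof of Thm 1.2)] -/
theorem IsAnsatzSolution.sqIntegrable (h : IsAnsatzSolution c v₀ v π) (hc : 1 < c)
    (hv₀ : FluidPDE.nsRescaleData c v₀ = v₀)
    (hV : IsCaloricLocalLerayField v₀ (UnboundedOperators.heatExtension v₀))
    (T : ℝ) {K : Set ℝ³} (hK : IsCompact K) :
    ∫⁻ z in Ioo 0 T ×ˢ K, ‖v z.1 z.2‖ₑ ^ 2 < ⊤ := by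
  have hmeas := hV.aemeasurable_enorm_sq T K hK.isClosed.measurableSet
  calc ∫⁻ z in Ioo 0 T ×ˢ K, ‖v z.1 z.2‖ₑ ^ 2
      ≤ ∫⁻ z in Ioo 0 T ×ˢ K, (2 * ‖v z.1 z.2 - UnboundedOperators.heatExtension v₀ z.1 z.2‖ₑ ^ 2 +
          2 * ‖UnboundedOperators.heatExtension v₀ z.1 z.2‖ₑ ^ 2) :=
        lintegral_mono fun z => enorm_sq_le_sub_heat_add z.1 z.2
    _ = (∫⁻ z in Ioo 0 T ×ˢ K, 2 * ‖v z.1 z.2 - UnboundedOperators.heatExtension v₀ z.1 z.2‖ₑ ^ 2) +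
          ∫⁻ z in Ioo 0 T ×ˢ K, 2 * ‖UnboundedOperators.heatExtension v₀ z.1 z.2‖ₑ ^ 2 :=
        lintegral_add_right' _ (hmeas.const_mul 2)
    _ < ⊤ := by
        rw [lintegral_const_mul' _ _ ENNReal.ofNat_ne_top,
          lintegral_const_mul' _ _ ENNReal.ofNat_ne_top]
        refine ENNReal.add_lt_top.2 ⟨ENNReal.mul_lt_top (by simp) ?_,
          ENNReal.mul_lt_top (by simp) (hV.setLIntegral_sq_lt_top T hK)⟩
        exact lt_of_le_of_lt (lintegral_mono_set (prod_mono Subset.rfl (subset_univ K)))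
          (h.setLIntegral_sub_heat_sq_lt_top hc hv₀ T)

/-- **Uniformly local energy of `v`** ([BT1] §4, "Locally finite energy"): for every `R > 0` there
is `C` with `∫_{B_R(x₀)} |v(t)|² ≤ C` for all `t ∈ (0, R²)` and all `x₀`, namely
`2 C₁ R + 2 C₂(R)` from the `t^{1/4}`-law and the uniformly local energy of `e^{tΔ}v₀`. [cite: BradshawTsai2017AHP, §4 (proof of Thm 1.2)] -/
theorem IsAnsatzSolution.uniformLocalEnergy (h : IsAnsatzSolution c v₀ v π) (hc : 1 < c)
    (hv₀ : FluidPDE.nsRescaleData c v₀ = v₀)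
    (hV : IsCaloricLocalLerayField v₀ (UnboundedOperators.heatExtension v₀))
    {R : ℝ} (hR : 0 < R) :
    ∃ C : ℝ≥0, ∀ t ∈ Ioo (0 : ℝ) (R ^ 2), ∀ x₀ : ℝ³, ∫⁻ x in ball x₀ R, ‖v t x‖ₑ ^ 2 ≤ C := by
  obtain ⟨C₁, hC₁⟩ := h.lintegral_enorm_sub_heat_sq_le hc hv₀
  obtain ⟨C₂, hC₂⟩ := hV.uniformLocalEnergy R hR
  set B : ℝ≥0∞ := 2 * (C₁ * ENNReal.ofReal R) + 2 * C₂ with hB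
  have hBtop : B ≠ ⊤ := ENNReal.add_ne_top.2
    ⟨ENNReal.mul_ne_top ENNReal.ofNat_ne_top (ENNReal.mul_ne_top ENNReal.coe_ne_top
      ENNReal.ofReal_ne_top), ENNReal.mul_ne_top ENNReal.ofNat_ne_top ENNReal.coe_ne_top⟩
  refine ⟨B.toNNReal, fun t ht x₀ => ?_⟩
  rw [ENNReal.coe_toNNReal hBtop]
  have hcont : Continuous (UnboundedOperators.heatExtension v₀ t) :=
    (hV.continuousOn.comp_continuous (Continuous.prodMk_right t : Continuous fun x : ℝ³ => (t, x))
      fun x => ⟨ht.1, mem_univ x⟩ : _)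
  have hmeas : AEMeasurable (fun x => 2 * ‖UnboundedOperators.heatExtension v₀ t x‖ₑ ^ 2)
      (volume.restrict (ball x₀ R)) :=
    ((hcont.measurable.enorm.pow_const 2).const_mul 2).aemeasurable
  have hsqrt : ENNReal.ofReal (Real.sqrt t) ≤ ENNReal.ofReal R := by
    refine ENNReal.ofReal_le_ofReal ?_
    rw [Real.sqrt_le_left hR.le]
    exact ht.2.le
  calc ∫⁻ x in ball x₀ R, ‖v t x‖ₑ ^ 2
      ≤ ∫⁻ x in ball x₀ R, (2 * ‖v t x - UnboundedOperators.heatExtension v₀ t x‖ₑ ^ 2 +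
          2 * ‖UnboundedOperators.heatExtension v₀ t x‖ₑ ^ 2) :=
        lintegral_mono fun x => enorm_sq_le_sub_heat_add t x
    _ = (∫⁻ x in ball x₀ R, 2 * ‖v t x - UnboundedOperators.heatExtension v₀ t x‖ₑ ^ 2) +
          ∫⁻ x in ball x₀ R, 2 * ‖UnboundedOperators.heatExtension v₀ t x‖ₑ ^ 2 :=
        lintegral_add_right' _ hmeas
    _ ≤ 2 * (C₁ * ENNReal.ofReal R) + 2 * C₂ := by
        rw [lintegral_const_mul' _ _ ENNReal.ofNat_ne_top,
          lintegral_const_mul' _ _ ENNReal.ofNat_ne_top]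
        refine add_le_add (mul_le_mul_right ?_ _) (mul_le_mul_right (hC₂ t ht x₀) _)
        exact (setLIntegral_le_lintegral _ _).trans ((hC₁ t ht.1).trans
          (mul_le_mul_right hsqrt _))

/-- **Attainment of the datum** ([BT1] §4, "Convergence to initial data"): `∫_K |v(t) − v₀|² ≤
2‖v(t) − e^{tΔ}v₀‖²_{L²} + 2∫_K |e^{tΔ}v₀ − v₀|² → 0` as `t → 0⁺`, by the `t^{1/4}`-law and the
`L²_loc`-convergence of the heat flow. [cite: BradshawTsai2017AHP, §4 (proof of Thm 1.2)] -/
theorem IsAnsatzSolution.initial (h : IsAnsatzSolution c v₀ v π) (hc : 1 < c)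
    (hv₀ : FluidPDE.nsRescaleData c v₀ = v₀) (hm₀ : AEStronglyMeasurable v₀ volume)
    (hV : IsCaloricLocalLerayField v₀ (UnboundedOperators.heatExtension v₀))
    {K : Set ℝ³} (hK : IsCompact K) :
    Tendsto (fun t => ∫⁻ x in K, ‖v t x - v₀ x‖ₑ ^ 2) (𝓝[>] 0) (𝓝 0) := by
  obtain ⟨C₁, hC₁⟩ := h.lintegral_enorm_sub_heat_sq_le hc hv₀
  -- the majorant `2 C₁ √t + 2 ∫_K |e^{tΔ}v₀ − v₀|²` tends to `0`
  have hmaj : Tendsto (fun t => 2 * (C₁ * ENNReal.ofReal (Real.sqrt t)) +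
      2 * ∫⁻ x in K, ‖UnboundedOperators.heatExtension v₀ t x - v₀ x‖ₑ ^ 2) (𝓝[>] 0) (𝓝 0) := by
    have h1 : Tendsto (fun t : ℝ => ENNReal.ofReal (Real.sqrt t)) (𝓝[>] 0) (𝓝 0) := by
      have : Tendsto (fun t : ℝ => Real.sqrt t) (𝓝 0) (𝓝 0) := by
        have := Real.continuous_sqrt.tendsto 0
        rwa [Real.sqrt_zero] at this
      have h2 := (ENNReal.continuous_ofReal.tendsto 0).comp this
      rw [ENNReal.ofReal_zero] at h2
      exact h2.mono_left nhdsWithin_le_nhds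
    have h2 : Tendsto (fun t : ℝ => (C₁ : ℝ≥0∞) * ENNReal.ofReal (Real.sqrt t)) (𝓝[>] 0)
        (𝓝 0) := by
      have := ENNReal.Tendsto.const_mul (a := (C₁ : ℝ≥0∞)) h1 (Or.inr ENNReal.coe_ne_top)
      rwa [mul_zero] at this
    have h3 : Tendsto (fun t : ℝ => 2 * ((C₁ : ℝ≥0∞) * ENNReal.ofReal (Real.sqrt t))) (𝓝[>] 0)
        (𝓝 0) := by
      have := ENNReal.Tendsto.const_mul (a := (2 : ℝ≥0∞)) h2 (Or.inr ENNReal.ofNat_ne_top)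
      rwa [mul_zero] at this
    have h4 : Tendsto (fun t : ℝ =>
        2 * ∫⁻ x in K, ‖UnboundedOperators.heatExtension v₀ t x - v₀ x‖ₑ ^ 2) (𝓝[>] 0)
        (𝓝 0) := by
      have := ENNReal.Tendsto.const_mul (a := (2 : ℝ≥0∞)) (hV.initial K hK)
        (Or.inr ENNReal.ofNat_ne_top)
      rwa [mul_zero] at this
    have := h3.add h4
    rwa [add_zero] at this
  refine tendsto_of_tendsto_of_tendsto_of_le_of_le' tendsto_const_nhds hmaj
    (Eventually.of_forall fun t => bot_le) ?_
  filter_upwards [self_mem_nhdsWithin] with t ht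
  have hcont : Continuous (UnboundedOperators.heatExtension v₀ t) :=
    (hV.continuousOn.comp_continuous (Continuous.prodMk_right t : Continuous fun x : ℝ³ => (t, x))
      fun x => ⟨ht, mem_univ x⟩ : _)
  have hmeas : AEMeasurable
      (fun x => 2 * ‖UnboundedOperators.heatExtension v₀ t x - v₀ x‖ₑ ^ 2)
      (volume.restrict K) :=
    (((hcont.aestronglyMeasurable.sub hm₀).enorm.pow_const 2).const_mul 2).restrict
  calc ∫⁻ x in K, ‖v t x - v₀ x‖ₑ ^ 2
      ≤ ∫⁻ x in K, (2 * ‖v t x - UnboundedOperators.heatExtension v₀ t x‖ₑ ^ 2 +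
          2 * ‖UnboundedOperators.heatExtension v₀ t x - v₀ x‖ₑ ^ 2) := by
        refine lintegral_mono fun x => ?_
        have := enorm_add_sq_le (v t x - UnboundedOperators.heatExtension v₀ t x)
          (UnboundedOperators.heatExtension v₀ t x - v₀ x)
        rwa [sub_add_sub_cancel] at this
    _ = (∫⁻ x in K, 2 * ‖v t x - UnboundedOperators.heatExtension v₀ t x‖ₑ ^ 2) +
          ∫⁻ x in K, 2 * ‖UnboundedOperators.heatExtension v₀ t x - v₀ x‖ₑ ^ 2 :=
        lintegral_add_right' _ hmeas
    _ ≤ 2 * (C₁ * ENNReal.ofReal (Real.sqrt t)) +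
          2 * ∫⁻ x in K, ‖UnboundedOperators.heatExtension v₀ t x - v₀ x‖ₑ ^ 2 := by
        rw [lintegral_const_mul' _ _ ENNReal.ofNat_ne_top,
          lintegral_const_mul' _ _ ENNReal.ofNat_ne_top]
        refine add_le_add (mul_le_mul_right ?_ _) le_rfl
        exact (setLIntegral_le_lintegral _ _).trans (hC₁ t ht)

/-- **Tails of the finite space–time energy of `v − e^{tΔ}v₀`**: on `(0,R²) × {|x| ≥ n}` the
square integral of `v − e^{tΔ}v₀` tends to `0` as `n → ∞` (the integral over `(0,R²) × ℝ³` is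
finite and exhausted by the cylinders `(0,R²) × B_n`). [cite: BradshawTsai2017AHP, §4 (proof of Thm 1.2)] -/
theorem IsAnsatzSolution.tendsto_tail_sub_heat (h : IsAnsatzSolution c v₀ v π) (hc : 1 < c)
    (hv₀ : FluidPDE.nsRescaleData c v₀ = v₀) (R : ℝ) :
    Tendsto (fun n : ℕ => ∫⁻ z in Ioo 0 (R ^ 2) ×ˢ (ball (0 : ℝ³) n)ᶜ,
      ‖v z.1 z.2 - UnboundedOperators.heatExtension v₀ z.1 z.2‖ₑ ^ 2) atTop (𝓝 0) := by
  set f : ℝ × ℝ³ → ℝ≥0∞ := fun z =>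
    ‖v z.1 z.2 - UnboundedOperators.heatExtension v₀ z.1 z.2‖ₑ ^ 2 with hf
  set μ : Measure (ℝ × ℝ³) := volume.restrict (Ioo 0 (R ^ 2) ×ˢ (univ : Set ℝ³)) with hμ
  have hI : ∫⁻ z, f z ∂μ < ⊤ := h.setLIntegral_sub_heat_sq_lt_top hc hv₀ (R ^ 2)
  -- the cylinders `ℝ × B_n` inside the restricted measure
  set A : ℕ → Set (ℝ × ℝ³) := fun n => (univ : Set ℝ) ×ˢ ball (0 : ℝ³) n with hA
  have hAm : ∀ n, MeasurableSet (A n) := fun n => MeasurableSet.univ.prod measurableSet_ball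
  have hμA : ∀ S : Set ℝ³, μ.restrict ((univ : Set ℝ) ×ˢ S) =
      volume.restrict (Ioo 0 (R ^ 2) ×ˢ S) := by
    intro S
    rw [hμ, Measure.restrict_restrict' (measurableSet_Ioo.prod MeasurableSet.univ), prod_inter_prod,
      univ_inter, inter_univ]
  have hdir : Directed (· ⊆ ·) A := by
    refine Monotone.directed_le fun m n hmn => prod_mono Subset.rfl (ball_subset_ball ?_)
    exact_mod_cast hmn
  have hUnion : (⋃ n, A n) = univ := by
    refine eq_univ_of_forall fun z => mem_iUnion.2 ?_
    obtain ⟨n, hn⟩ := exists_nat_gt ‖z.2‖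
    exact ⟨n, mem_univ _, mem_ball_zero_iff.2 hn⟩
  have hsup : ∫⁻ z, f z ∂μ = ⨆ n, ∫⁻ z in A n, f z ∂μ := by
    rw [← setLIntegral_iUnion_of_directed f hdir, hUnion, Measure.restrict_univ]
  have hmono : Monotone fun n => ∫⁻ z in A n, f z ∂μ := fun m n hmn =>
    lintegral_mono_set (prod_mono Subset.rfl (ball_subset_ball (by exact_mod_cast hmn)))
  have hJ : Tendsto (fun n => ∫⁻ z in A n, f z ∂μ) atTop (𝓝 (∫⁻ z, f z ∂μ)) := by
    rw [hsup]; exact tendsto_atTop_iSup hmono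
  have htail : ∀ n, ∫⁻ z in (A n)ᶜ, f z ∂μ = ∫⁻ z, f z ∂μ - ∫⁻ z in A n, f z ∂μ := fun n =>
    setLIntegral_compl (hAm n) (lt_of_le_of_lt (setLIntegral_le_lintegral _ _) hI).ne
  have hlim : Tendsto (fun n => ∫⁻ z in (A n)ᶜ, f z ∂μ) atTop (𝓝 0) := by
    simp_rw [htail]
    have := ENNReal.Tendsto.sub tendsto_const_nhds hJ (Or.inl hI.ne)
    rwa [tsub_self] at this
  refine hlim.congr fun n => ?_
  have hcompl : (A n)ᶜ = (univ : Set ℝ) ×ˢ (ball (0 : ℝ³) n)ᶜ := by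
    rw [hA, compl_prod_eq_union, compl_univ, empty_prod, empty_union]
  rw [hcompl, hμA]

/-- The `(0,R²) × B_R(x₀)`-energy of `v − e^{tΔ}v₀` tends to `0` as `|x₀| → ∞`
(`B_R(x₀) ⊆ {|x| ≥ n}` once `|x₀| ≥ n + R`). [cite: BradshawTsai2017AHP, §4 (proof of Thm 1.2)] -/
theorem IsAnsatzSolution.tendsto_cocompact_sub_heat (h : IsAnsatzSolution c v₀ v π) (hc : 1 < c)
    (hv₀ : FluidPDE.nsRescaleData c v₀ = v₀) (R : ℝ) :
    Tendsto (fun x₀ : ℝ³ => ∫⁻ z in Ioo 0 (R ^ 2) ×ˢ ball x₀ R,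
      ‖v z.1 z.2 - UnboundedOperators.heatExtension v₀ z.1 z.2‖ₑ ^ 2) (cocompact ℝ³) (𝓝 0) := by
  refine ENNReal.tendsto_nhds_zero.2 fun ε hε => ?_
  obtain ⟨N, hN⟩ := (ENNReal.tendsto_atTop_zero.1 (h.tendsto_tail_sub_heat hc hv₀ R)) ε hε
  have hmem : (closedBall (0 : ℝ³) (N + R))ᶜ ∈ cocompact ℝ³ :=
    (isCompact_closedBall (0 : ℝ³) (N + R)).compl_mem_cocompact
  filter_upwards [hmem] with x₀ hx₀
  have hsub : ball x₀ R ⊆ (ball (0 : ℝ³) N)ᶜ := by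
    intro y hy
    rw [mem_compl_iff, mem_closedBall_zero_iff, not_le] at hx₀
    rw [mem_compl_iff, mem_ball_zero_iff, not_lt]
    rw [mem_ball_iff_norm] at hy
    have := norm_sub_norm_le x₀ y
    rw [norm_sub_rev] at this
    linarith
  exact (lintegral_mono_set (prod_mono Subset.rfl hsub)).trans (hN N le_rfl)

/-- **Decay at spatial infinity** ([BT1] §4): `∫₀^{R²}∫_{B_R(x₀)} |v|² ≤ 2∫∫_{B_R(x₀)} |v − e^{tΔ}v₀|²
+ 2∫∫_{B_R(x₀)} |e^{tΔ}v₀|² → 0` as `|x₀| → ∞` ("the `λ`-DSS scaling implies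
`v − e^{tΔ}v₀ ∈ L²(0,R²;ℝ³)` [i.e. `L²((0,R²) × ℝ³)`]. Together with the fact that `e^{tΔ}v₀(x)`
satisfies the same decay requirements at spatial infinity as a local Leray solution … this
implies that `lim_{|x₀|→∞} ∫₀^{R²}∫_{B_R(x₀)} |v(x,t)|² dx dt = 0`"). [cite: BradshawTsai2017AHP, §4 (proof of Thm 1.2)] -/
theorem IsAnsatzSolution.decay (h : IsAnsatzSolution c v₀ v π) (hc : 1 < c)
    (hv₀ : FluidPDE.nsRescaleData c v₀ = v₀)
    (hV : IsCaloricLocalLerayField v₀ (UnboundedOperators.heatExtension v₀)) {R : ℝ} (hR : 0 < R) :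
    Tendsto (fun x₀ : ℝ³ => ∫⁻ z in Ioo 0 (R ^ 2) ×ˢ ball x₀ R, ‖v z.1 z.2‖ₑ ^ 2)
      (cocompact ℝ³) (𝓝 0) := by
  have hmaj : Tendsto (fun x₀ : ℝ³ => 2 * (∫⁻ z in Ioo 0 (R ^ 2) ×ˢ ball x₀ R,
      ‖v z.1 z.2 - UnboundedOperators.heatExtension v₀ z.1 z.2‖ₑ ^ 2) +
      2 * ∫⁻ z in Ioo 0 (R ^ 2) ×ˢ ball x₀ R, ‖UnboundedOperators.heatExtension v₀ z.1 z.2‖ₑ ^ 2)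
      (cocompact ℝ³) (𝓝 0) := by
    have h1 := ENNReal.Tendsto.const_mul (a := (2 : ℝ≥0∞)) (h.tendsto_cocompact_sub_heat hc hv₀ R)
      (Or.inr ENNReal.ofNat_ne_top)
    have h2 := ENNReal.Tendsto.const_mul (a := (2 : ℝ≥0∞)) (hV.decay R hR)
      (Or.inr ENNReal.ofNat_ne_top)
    rw [mul_zero] at h1 h2
    have := h1.add h2
    rwa [add_zero] at this
  refine tendsto_of_tendsto_of_tendsto_of_le_of_le tendsto_const_nhds hmaj (fun x₀ => bot_le)
    fun x₀ => ?_
  have hmeas := (hV.aemeasurable_enorm_sq (R ^ 2) (ball x₀ R) measurableSet_ball).const_mul 2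
  calc ∫⁻ z in Ioo 0 (R ^ 2) ×ˢ ball x₀ R, ‖v z.1 z.2‖ₑ ^ 2
      ≤ ∫⁻ z in Ioo 0 (R ^ 2) ×ˢ ball x₀ R,
          (2 * ‖v z.1 z.2 - UnboundedOperators.heatExtension v₀ z.1 z.2‖ₑ ^ 2 +
          2 * ‖UnboundedOperators.heatExtension v₀ z.1 z.2‖ₑ ^ 2) :=
        lintegral_mono fun z => enorm_sq_le_sub_heat_add z.1 z.2
    _ = (∫⁻ z in Ioo 0 (R ^ 2) ×ˢ ball x₀ R,
          2 * ‖v z.1 z.2 - UnboundedOperators.heatExtension v₀ z.1 z.2‖ₑ ^ 2) +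
          ∫⁻ z in Ioo 0 (R ^ 2) ×ˢ ball x₀ R,
            2 * ‖UnboundedOperators.heatExtension v₀ z.1 z.2‖ₑ ^ 2 :=
        lintegral_add_right' _ hmeas
    _ = _ := by
        rw [lintegral_const_mul' _ _ ENNReal.ofNat_ne_top, lintegral_const_mul' _ _ ENNReal.ofNat_ne_top]

end BradshawTsai2017

end Literature.Analysis.FluidPDE

end
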